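import Literature.NumberTheory.EllipticCurves.QuadraticTwistGoodReductionCharTwoProofs
import HarnessLib

/-!
# Quadratic twists of an elliptic curve with good supersingular reduction, `2` a uniformiser:
# Kodaira types `II*`, `II`; and the explicit twist models over the fraction field

`Proofs` file (theorems only, no definitions, no named facts) in topic
`NumberTheory/EllipticCurves`, second half of `QuadraticTwistGoodReductionCharTwoProofs`
(companion of the named fact
`Literature.NumberTheory.EllipticCurves.BarriosEtAl2025_quadraticTwist_two_of_goodReduction`,
Barrios–Roy–Sahajpal–Tallana–Tobin–Wiersema, Res. Number Theory 11 (2025), Thm. 5.1, rows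
`R = I₀`).  Setting as there: `R` a DVR with perfect residue field, `2 = ϖ ε` (`ε ∈ Rˣ`), `V` a
Weierstrass equation over `R` with unit discriminant, fraction field `K`.

* **`a₁ = 0`** (the supersingular normal form, `exists_smul_a₁_eq_zero`; then `a₃ ∈ Rˣ`):
  `d ≡ 3 (4)`: `⟨0, 4da₂, 8a₃, 16d²a₄, 16(d³b₆ - a₃²)⟩` is step-9 normalised with `ord a₆ = 5`,
  so Tate's algorithm (Silverman *ATAEC* IV.9.4, literal implementation
  `WeierstrassCurve.kodairaSymbolOfMinimal`) exits at Step 10: **type `II*`**, `ord Δ = 12`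
  (`kodairaSymbolOfMinimal_twistGoodSupersingular_three`); `d = 2d₁ ≡ 2 (4)`:
  `⟨0, 2d₁a₂, 0, 4d₁²a₄, 2d₁³b₆⟩` exits at Step 3: **type `II`**, `ord Δ = 6`
  (`kodairaSymbolOfMinimal_twistGoodSupersingular_two`).
* **The models are `K`-isomorphic to the twist** `(V ⊗ K).quadraticTwist d`
  (`y² = x³ + (d b₂/4)x² + (d² b₄/2)x + d³ b₆/4`): `smul_quadraticTwist_eq_modelThree`
  (`(½; 0, ½, 0)`, ordinary, `d` odd), `smul_quadraticTwist_eq_modelTwo` (`(½; 0, 0, 0)`,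
  ordinary), `smul_quadraticTwist_eq_modelThree'` (`(½; 0, 0, a₃/2)`, supersingular, `d` odd),
  `quadraticTwist_eq_modelTwo'` (identity, supersingular, `d = 2d₁`).  Silverman *AEC* III.1
  Table 3.1.

## References

* A. J. Barrios, M. Roy, N. Sahajpal, D. Tallana, B. Tobin, H. Wiersema, *Local data of elliptic
  curves under quadratic twist*, Res. Number Theory 11 (2025), Thm. 5.1, §5 tables, rows `I₀`
  (arXiv:2501.03209 pp. 15–16), §5.1 Case 1, §5.2 Case 1. [BarriosEtAl2025]
* J. H. Silverman, *Advanced Topics in the Arithmetic of Elliptic Curves*, GTM 151 (1994), IV.9.4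
  (Tate's algorithm) and Table 4.1. [SilvermanATAEC1994]
* J. H. Silverman, *The Arithmetic of Elliptic Curves*, 2nd ed. (2009), III.1 Table 3.1,
  X.5 Cor. 5.4 (quadratic twists). [SilvermanAEC2009]
-/

noncomputable section

open IsLocalRing
open IsDiscreteValuationRing hiding maximalIdeal

namespace Literature.NumberTheory.EllipticCurves

namespace TwistGoodTwo

open Literature.NumberTheory.DiophantineGeometry Literature.NumberTheory.DiophantineGeometry.TateAlgorithm

variable {R : Type*} [CommRing R] [IsDomain R] [IsDiscreteValuationRing R]

/-- An odd integer is a unit of `R` when `2 = ϖ ε` (it is `1 + ϖ(⋯)`). [folklore] -/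
private theorem isUnit_intCast_of_odd' {ε : R} (hε : (2 : R) = uniformizer R * ε) {n : ℤ}
    (hn : Odd n) : IsUnit (n : R) := by
  obtain ⟨k, rfl⟩ := hn
  have e : ((2 * k + 1 : ℤ) : R) = 1 + uniformizer R * (ε * k) := by
    push_cast; rw [hε]; ring
  rw [e]
  exact isUnit_one_add_uniformizer_mul _

/-- With `2 = ϖ ε`: `2 ^ n = ϖ ^ n ε ^ n`. [folklore] -/
private theorem two_pow_eq' {ε : R} (hε : (2 : R) = uniformizer R * ε) (n : ℕ) :
    (2 : R) ^ n = uniformizer R ^ n * ε ^ n := by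
  rw [hε, mul_pow]

/-! ### `a₁ = 0`: the models of the twist and their Kodaira types `II*`, `II` -/

section Supersingular

variable [PerfectField (ResidueField R)] {ε : R} (hε : (2 : R) = uniformizer R * ε)
  (hεu : IsUnit ε) (V : WeierstrassCurve R) (h1 : V.a₁ = 0) (hΔ : IsUnit V.Δ)
include hε hεu h1 hΔ

/-- **`d ≡ 3 (mod 4)`, supersingular case: Kodaira type `II*` with `ord Δ = 12`.**  For
`V = ⟨0, a₂, a₃, a₄, a₆⟩` with `Δ ∈ Rˣ` (so `a₃ ∈ Rˣ`) and `d = 4k + 3`, the model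
`M = ⟨0, 4da₂, 8a₃, 16d²a₄, 16(d³b₆ - a₃²)⟩` (the twist rescaled by `u = 1/2` and translated by
`t = a₃/2`, `smul_quadraticTwist_eq_modelThree'`) is step-9 normalised (`π² ∣ a₂`, `π³ ∣ a₃`,
`π⁴ ∣ a₄`) with `a₆ = ϖ⁵·unit` (`d³b₆ - a₃² = (d³ - 1)a₃² + 4d³a₆`, `d³ - 1 = 2·odd`), so Tate's
algorithm exits at Step 10 with `II*`; `Δ(M) = 2¹² d⁶ Δ(V)` has `ord = 12`.  Barrios et al.
2025, Thm. 5.1, table `v(d) = 0`, row `I₀`, `d ≡ 3 mod 4`, `v(a₁) ≥ 1`: `II*`, `(δ, δ^d) = (0, 12)`;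
Silverman *ATAEC* IV.9.4 Steps 8–10.
[cite: BarriosEtAl2025, Thm. 5.1, §5 table v(d) = 0, row I₀ (arXiv p. 15)]
[cite: SilvermanATAEC1994, IV.9.4 Steps 8–10 (PDF p. 346)] -/
theorem kodairaSymbolOfMinimal_twistGoodSupersingular_three {d k : ℤ} (hd : d = 4 * k + 3) :
    (⟨0, 4 * (d : R) * V.a₂, 8 * V.a₃, 16 * (d : R) ^ 2 * V.a₄,
        16 * ((d : R) ^ 3 * (V.a₃ ^ 2 + 4 * V.a₆) - V.a₃ ^ 2)⟩ :
        WeierstrassCurve R).kodairaSymbolOfMinimal = .IIstar ∧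
      (addVal R (⟨0, 4 * (d : R) * V.a₂, 8 * V.a₃, 16 * (d : R) ^ 2 * V.a₄,
        16 * ((d : R) ^ 3 * (V.a₃ ^ 2 + 4 * V.a₆) - V.a₃ ^ 2)⟩ : WeierstrassCurve R).Δ).toNat = 12 ∧
      (⟨0, 4 * (d : R) * V.a₂, 8 * V.a₃, 16 * (d : R) ^ 2 * V.a₄,
        16 * ((d : R) ^ 3 * (V.a₃ ^ 2 + 4 * V.a₆) - V.a₃ ^ 2)⟩ : WeierstrassCurve R).Δ =
        2 ^ 12 * (d : R) ^ 6 * V.Δ := by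
  set ϖ := uniformizer R with hϖdef
  have hϖ : Irreducible ϖ := irreducible_uniformizer
  have h3u : IsUnit V.a₃ := isUnit_a₃_of_a₁_eq_zero hε V h1 hΔ
  set M : WeierstrassCurve R := ⟨0, 4 * (d : R) * V.a₂, 8 * V.a₃, 16 * (d : R) ^ 2 * V.a₄,
    16 * ((d : R) ^ 3 * (V.a₃ ^ 2 + 4 * V.a₆) - V.a₃ ^ 2)⟩ with hM
  have hdu : IsUnit (d : R) := isUnit_intCast_of_odd' hε ⟨2 * k + 1, by rw [hd]; ring⟩
  have hMΔ : M.Δ = 2 ^ 12 * (d : R) ^ 6 * V.Δ := by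
    simp only [hM, WeierstrassCurve.Δ, WeierstrassCurve.b₂, WeierstrassCurve.b₄,
      WeierstrassCurve.b₆, WeierstrassCurve.b₈, h1]
    ring
  -- `d³ - 1 = 2 m` with `m` odd
  set m : ℤ := 32 * k ^ 3 + 72 * k ^ 2 + 54 * k + 13 with hm
  have hd3 : (d : R) ^ 3 = 1 + 2 * (m : R) := by
    rw [hd, hm]; push_cast; ring
  have hmu : IsUnit (m : R) :=
    isUnit_intCast_of_odd' hε ⟨16 * k ^ 3 + 36 * k ^ 2 + 27 * k + 6, by rw [hm]; ring⟩
  set U : R := ε ^ 5 * ((m : R) * V.a₃ ^ 2 + ϖ * (ε * (d : R) ^ 3 * V.a₆)) with hU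
  have hUu : IsUnit U :=
    (hεu.pow 5).mul (isUnit_add_mul_of_isUnit hϖ (hmu.mul (h3u.pow 2)) _)
  have e6 : M.a₆ = ϖ ^ 5 * U := by
    change 16 * ((d : R) ^ 3 * (V.a₃ ^ 2 + 4 * V.a₆) - V.a₃ ^ 2) = ϖ ^ 5 * U
    have e : 16 * ((d : R) ^ 3 * (V.a₃ ^ 2 + 4 * V.a₆) - V.a₃ ^ 2) =
        2 ^ 5 * ((m : R) * V.a₃ ^ 2 + 2 * (d : R) ^ 3 * V.a₆) := by
      rw [mul_add, ← mul_assoc, hd3]; ring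
    rw [e, hU, two_pow_eq' hε, hε]; ring
  have g1 : ϖ ∣ M.a₁ := dvd_zero _
  have g2 : ϖ ^ 2 ∣ M.a₂ := by
    change ϖ ^ 2 ∣ 4 * (d : R) * V.a₂
    rw [show (4 : R) = 2 ^ 2 by norm_num, two_pow_eq' hε]
    exact ⟨ε ^ 2 * (d : R) * V.a₂, by ring⟩
  have g3 : ϖ ^ 3 ∣ M.a₃ := by
    change ϖ ^ 3 ∣ 8 * V.a₃
    rw [show (8 : R) = 2 ^ 3 by norm_num, two_pow_eq' hε]
    exact ⟨ε ^ 3 * V.a₃, by ring⟩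
  have g4 : ϖ ^ 4 ∣ M.a₄ := by
    change ϖ ^ 4 ∣ 16 * (d : R) ^ 2 * V.a₄
    rw [show (16 : R) = 2 ^ 4 by norm_num, two_pow_eq' hε]
    exact ⟨ε ^ 4 * (d : R) ^ 2 * V.a₄, by ring⟩
  have g6 : ϖ ^ 5 ∣ M.a₆ := ⟨U, e6⟩
  have h10 : ¬ ϖ ^ 6 ∣ M.a₆ := by rw [e6]; exact not_pow_succ_dvd_pow_mul hUu 5
  have hord : (addVal R M.Δ).toNat = 12 := by
    refine addVal_toNat_eq_of_eq hϖ isUnit_one ((hεu.pow 12).mul ((hdu.pow 6).mul hΔ)) ?_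
    rw [one_mul, hMΔ, two_pow_eq' hε]; ring
  exact ⟨kodairaSymbolOfMinimal_eq_IIstar_of_step9 g1 g2 g3 g4 g6 h10, hord, hMΔ⟩

/-- **`d ≡ 2 (mod 4)`, supersingular case: Kodaira type `II` with `ord Δ = 6`.**  For
`V = ⟨0, a₂, a₃, a₄, a₆⟩` with `Δ ∈ Rˣ` (so `b₆ = a₃² + 4a₆ ∈ Rˣ`) and `d = 2d₁`, `d₁ = 2k + 1`,
the twist `V^{(d)} = ⟨0, 2d₁a₂, 0, 4d₁²a₄, 2d₁³b₆⟩` is already integral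
(`quadraticTwist_eq_modelTwo'`) and step-2 normalised with `a₆ = ϖ·unit`, so Tate's algorithm
exits at Step 3 with `II`; `Δ = 2⁶ d₁⁶ Δ(V)` has `ord = 6`.  Barrios et al. 2025, Thm. 5.1,
table `v(d) = 1`, row `I₀`, `v(a₁) ≥ 1`: `II`, `(δ, δ^d) = (0, 6)`; Silverman *ATAEC* IV.9.4
Steps 1–3.
[cite: BarriosEtAl2025, Thm. 5.1, §5 table v(d) = 1, row I₀ (arXiv p. 16)]
[cite: SilvermanATAEC1994, IV.9.4 Steps 1–3 (PDF pp. 344–345)] -/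
theorem kodairaSymbolOfMinimal_twistGoodSupersingular_two {d₁ k : ℤ} (hd₁ : d₁ = 2 * k + 1) :
    (⟨0, 2 * (d₁ : R) * V.a₂, 0, 4 * (d₁ : R) ^ 2 * V.a₄,
        2 * (d₁ : R) ^ 3 * (V.a₃ ^ 2 + 4 * V.a₆)⟩ : WeierstrassCurve R).kodairaSymbolOfMinimal = .II ∧
      (addVal R (⟨0, 2 * (d₁ : R) * V.a₂, 0, 4 * (d₁ : R) ^ 2 * V.a₄,
        2 * (d₁ : R) ^ 3 * (V.a₃ ^ 2 + 4 * V.a₆)⟩ : WeierstrassCurve R).Δ).toNat = 6 ∧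
      (⟨0, 2 * (d₁ : R) * V.a₂, 0, 4 * (d₁ : R) ^ 2 * V.a₄,
        2 * (d₁ : R) ^ 3 * (V.a₃ ^ 2 + 4 * V.a₆)⟩ : WeierstrassCurve R).Δ =
        2 ^ 6 * (d₁ : R) ^ 6 * V.Δ := by
  set ϖ := uniformizer R with hϖdef
  have hϖ : Irreducible ϖ := irreducible_uniformizer
  have h3u : IsUnit V.a₃ := isUnit_a₃_of_a₁_eq_zero hε V h1 hΔ
  set M : WeierstrassCurve R := ⟨0, 2 * (d₁ : R) * V.a₂, 0, 4 * (d₁ : R) ^ 2 * V.a₄,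
    2 * (d₁ : R) ^ 3 * (V.a₃ ^ 2 + 4 * V.a₆)⟩ with hM
  have hd₁u : IsUnit (d₁ : R) := isUnit_intCast_of_odd' hε ⟨k, hd₁⟩
  have hb₆u : IsUnit (V.a₃ ^ 2 + 4 * V.a₆) := by
    have : V.a₃ ^ 2 + 4 * V.a₆ = V.a₃ ^ 2 + ϖ * (ε * 2 * V.a₆) := by
      rw [show (4 : R) = 2 * 2 by norm_num, hε]; ring
    rw [this]; exact isUnit_add_mul_of_isUnit hϖ (h3u.pow 2) _
  have hMΔ : M.Δ = 2 ^ 6 * (d₁ : R) ^ 6 * V.Δ := by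
    simp only [hM, WeierstrassCurve.Δ, WeierstrassCurve.b₂, WeierstrassCurve.b₄,
      WeierstrassCurve.b₆, WeierstrassCurve.b₈, h1]
    ring
  have e6 : M.a₆ = ϖ * (ε * (d₁ : R) ^ 3 * (V.a₃ ^ 2 + 4 * V.a₆)) := by
    change 2 * (d₁ : R) ^ 3 * (V.a₃ ^ 2 + 4 * V.a₆) = _
    rw [hε]; ring
  have hΔd : ϖ ∣ M.Δ := by
    rw [hMΔ, two_pow_eq' hε]
    exact ⟨ϖ ^ 5 * ε ^ 6 * (d₁ : R) ^ 6 * V.Δ, by ring⟩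
  have n3 : ϖ ∣ M.a₃ := dvd_zero _
  have n4 : ϖ ∣ M.a₄ := by
    change ϖ ∣ 4 * (d₁ : R) ^ 2 * V.a₄
    rw [show (4 : R) = 2 * 2 by norm_num, hε]
    exact ⟨ε * (ϖ * ε) * (d₁ : R) ^ 2 * V.a₄, by ring⟩
  have n6 : ϖ ∣ M.a₆ := ⟨_, e6⟩
  have hb₂ : ϖ ∣ M.b₂ := by
    change ϖ ∣ (0 : R) ^ 2 + 4 * (2 * (d₁ : R) * V.a₂)
    rw [hε]; exact ⟨4 * (ε * (d₁ : R) * V.a₂), by ring⟩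
  have ha₆ : ¬ ϖ ^ 2 ∣ M.a₆ := by
    rw [e6]; exact not_sq_dvd_uniformizer_mul ((hεu.mul (hd₁u.pow 3)).mul hb₆u)
  have hord : (addVal R M.Δ).toNat = 6 := by
    refine addVal_toNat_eq_of_eq hϖ isUnit_one ((hεu.pow 6).mul ((hd₁u.pow 6).mul hΔ)) ?_
    rw [one_mul, hMΔ, two_pow_eq' hε]; ring
  exact ⟨kodairaSymbolOfMinimal_eq_II_of_step2 hΔd n3 n4 n6 hb₂ ha₆, hord, hMΔ⟩

end Supersingular

/-! ### The models as `K`-isomorphic images of the quadratic twist -/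

section Models

variable {K : Type*} [Field K] [Algebra R K] [IsFractionRing R K]

/-- `2 ≠ 0` and `4 ≠ 0` in the fraction field when `2 = ϖ ε` in `R`. [folklore] -/
private theorem two_ne_zero_and_four_ne_zero {ε : R} (hε : (2 : R) = uniformizer R * ε)
    (hεu : IsUnit ε) : (2 : K) ≠ 0 ∧ (4 : K) ≠ 0 := by
  have h2R : (2 : R) ≠ 0 := by
    rw [hε]; exact mul_ne_zero irreducible_uniformizer.ne_zero hεu.ne_zero
  have h20 : (2 : K) ≠ 0 := by
    have := (map_ne_zero_iff (algebraMap R K) (IsFractionRing.injective R K)).mpr h2R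
    rwa [map_ofNat] at this
  refine ⟨h20, ?_⟩
  rw [show (4 : K) = 2 * 2 by norm_num]
  exact mul_ne_zero h20 h20

/-- **Ordinary case, `d` odd: `(½; 0, ½, 0) • (V ⊗ K)^{(d)} = ⟨2, d(1 + 4a₂) - 1, 0, 16d²a₄, 64d³a₆⟩`**
for `a₁ = 1`, `a₃ = 0` (`b₂ = 1 + 4a₂`, `b₄ = 2a₄`, `b₆ = 4a₆`; `2 ≠ 0` in `K` because
`2 = ϖε ≠ 0` in `R`).  Silverman *AEC* III.1 Table 3.1 and X.5 Cor. 5.4.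
[cite: SilvermanAEC2009, III.1 Table 3.1] -/
theorem smul_quadraticTwist_eq_modelThree {ε : R} (hε : (2 : R) = uniformizer R * ε)
    (hεu : IsUnit ε) (V : WeierstrassCurve R) (h1 : V.a₁ = 1) (h3 : V.a₃ = 0) (d : ℤ) :
    ∃ C : WeierstrassCurve.VariableChange K,
      C • ((V.baseChange K).quadraticTwist (d : K)) =
        (⟨2, (d : R) * (1 + 4 * V.a₂) - 1, 0, 16 * (d : R) ^ 2 * V.a₄, 64 * (d : R) ^ 3 * V.a₆⟩ :
          WeierstrassCurve R).baseChange K := by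
  obtain ⟨h20, h40⟩ := two_ne_zero_and_four_ne_zero (K := K) hε hεu
  refine ⟨⟨Units.mk0 2⁻¹ (inv_ne_zero h20), 0, 2⁻¹, 0⟩, ?_⟩
  ext
  · simp only [WeierstrassCurve.variableChange_a₁, WeierstrassCurve.quadraticTwist_a₁,
      WeierstrassCurve.baseChange, WeierstrassCurve.map_a₁, Units.val_inv_eq_inv_val,
      Units.val_mk0, inv_inv, map_ofNat]
    field_simp
    ring
  · simp only [WeierstrassCurve.variableChange_a₂, WeierstrassCurve.quadraticTwist_a₁,
      WeierstrassCurve.quadraticTwist_a₂, WeierstrassCurve.b₂, WeierstrassCurve.baseChange,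
      WeierstrassCurve.map_a₁, WeierstrassCurve.map_a₂, h1, Units.val_inv_eq_inv_val,
      Units.val_mk0, inv_inv, map_one, map_sub, map_mul, map_add, map_intCast, map_ofNat]
    field_simp
    ring
  · simp only [WeierstrassCurve.variableChange_a₃, WeierstrassCurve.quadraticTwist_a₁,
      WeierstrassCurve.quadraticTwist_a₃, WeierstrassCurve.baseChange, WeierstrassCurve.map_a₃,
      map_zero]
    ring
  · simp only [WeierstrassCurve.variableChange_a₄, WeierstrassCurve.quadraticTwist_a₁,
      WeierstrassCurve.quadraticTwist_a₃, WeierstrassCurve.quadraticTwist_a₄,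
      WeierstrassCurve.b₄, WeierstrassCurve.baseChange, WeierstrassCurve.map_a₁,
      WeierstrassCurve.map_a₃, WeierstrassCurve.map_a₄, h1, h3, Units.val_inv_eq_inv_val,
      Units.val_mk0, inv_inv, map_one, map_zero, map_mul, map_pow, map_intCast, map_ofNat]
    field_simp
    ring
  · simp only [WeierstrassCurve.variableChange_a₆, WeierstrassCurve.quadraticTwist_a₁,
      WeierstrassCurve.quadraticTwist_a₃, WeierstrassCurve.quadraticTwist_a₄,
      WeierstrassCurve.quadraticTwist_a₆, WeierstrassCurve.b₆, WeierstrassCurve.baseChange,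
      WeierstrassCurve.map_a₃, WeierstrassCurve.map_a₆, h3, Units.val_inv_eq_inv_val,
      Units.val_mk0, inv_inv, map_zero, map_mul, map_pow, map_intCast, map_ofNat]
    field_simp
    ring

/-- **Ordinary case: `(½; 0, 0, 0) • (V ⊗ K)^{(d)} = ⟨0, d(1 + 4a₂), 0, 16d²a₄, 64d³a₆⟩`** for
`a₁ = 1`, `a₃ = 0`.  Silverman *AEC* III.1 Table 3.1. [cite: SilvermanAEC2009, III.1 Table 3.1] -/
theorem smul_quadraticTwist_eq_modelTwo {ε : R} (hε : (2 : R) = uniformizer R * ε)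
    (hεu : IsUnit ε) (V : WeierstrassCurve R) (h1 : V.a₁ = 1) (h3 : V.a₃ = 0) (d : ℤ) :
    ∃ C : WeierstrassCurve.VariableChange K,
      C • ((V.baseChange K).quadraticTwist (d : K)) =
        (⟨0, (d : R) * (1 + 4 * V.a₂), 0, 16 * (d : R) ^ 2 * V.a₄, 64 * (d : R) ^ 3 * V.a₆⟩ :
          WeierstrassCurve R).baseChange K := by
  obtain ⟨h20, h40⟩ := two_ne_zero_and_four_ne_zero (K := K) hε hεu
  refine ⟨⟨Units.mk0 2⁻¹ (inv_ne_zero h20), 0, 0, 0⟩, ?_⟩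
  ext
  · simp only [WeierstrassCurve.variableChange_a₁, WeierstrassCurve.quadraticTwist_a₁,
      WeierstrassCurve.baseChange, WeierstrassCurve.map_a₁, map_zero]
    ring
  · simp only [WeierstrassCurve.variableChange_a₂, WeierstrassCurve.quadraticTwist_a₁,
      WeierstrassCurve.quadraticTwist_a₂, WeierstrassCurve.b₂, WeierstrassCurve.baseChange,
      WeierstrassCurve.map_a₁, WeierstrassCurve.map_a₂, h1, Units.val_inv_eq_inv_val,
      Units.val_mk0, inv_inv, map_one, map_mul, map_add, map_intCast, map_ofNat]
    field_simp
    ring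
  · simp only [WeierstrassCurve.variableChange_a₃, WeierstrassCurve.quadraticTwist_a₁,
      WeierstrassCurve.quadraticTwist_a₃, WeierstrassCurve.baseChange, WeierstrassCurve.map_a₃,
      map_zero]
    ring
  · simp only [WeierstrassCurve.variableChange_a₄, WeierstrassCurve.quadraticTwist_a₁,
      WeierstrassCurve.quadraticTwist_a₃, WeierstrassCurve.quadraticTwist_a₄,
      WeierstrassCurve.b₄, WeierstrassCurve.baseChange, WeierstrassCurve.map_a₁,
      WeierstrassCurve.map_a₃, WeierstrassCurve.map_a₄, h1, h3, Units.val_inv_eq_inv_val,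
      Units.val_mk0, inv_inv, map_one, map_zero, map_mul, map_pow, map_intCast, map_ofNat]
    field_simp
    ring
  · simp only [WeierstrassCurve.variableChange_a₆, WeierstrassCurve.quadraticTwist_a₁,
      WeierstrassCurve.quadraticTwist_a₃, WeierstrassCurve.quadraticTwist_a₄,
      WeierstrassCurve.quadraticTwist_a₆, WeierstrassCurve.b₆, WeierstrassCurve.baseChange,
      WeierstrassCurve.map_a₃, WeierstrassCurve.map_a₆, h3, Units.val_inv_eq_inv_val,
      Units.val_mk0, inv_inv, map_zero, map_mul, map_pow, map_intCast, map_ofNat]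
    field_simp
    ring

/-- **Supersingular case, `d` odd:
`(½; 0, 0, a₃/2) • (V ⊗ K)^{(d)} = ⟨0, 4da₂, 8a₃, 16d²a₄, 16(d³b₆ - a₃²)⟩`** for `a₁ = 0`
(`b₂ = 4a₂`, `b₄ = 2a₄`, `b₆ = a₃² + 4a₆`).  Silverman *AEC* III.1 Table 3.1.
[cite: SilvermanAEC2009, III.1 Table 3.1] -/
theorem smul_quadraticTwist_eq_modelThree' {ε : R} (hε : (2 : R) = uniformizer R * ε)
    (hεu : IsUnit ε) (V : WeierstrassCurve R) (h1 : V.a₁ = 0) (d : ℤ) :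
    ∃ C : WeierstrassCurve.VariableChange K,
      C • ((V.baseChange K).quadraticTwist (d : K)) =
        (⟨0, 4 * (d : R) * V.a₂, 8 * V.a₃, 16 * (d : R) ^ 2 * V.a₄,
          16 * ((d : R) ^ 3 * (V.a₃ ^ 2 + 4 * V.a₆) - V.a₃ ^ 2)⟩ : WeierstrassCurve R).baseChange K := by
  obtain ⟨h20, h40⟩ := two_ne_zero_and_four_ne_zero (K := K) hε hεu
  refine ⟨⟨Units.mk0 2⁻¹ (inv_ne_zero h20), 0, 0, algebraMap R K V.a₃ / 2⟩, ?_⟩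
  ext
  · simp only [WeierstrassCurve.variableChange_a₁, WeierstrassCurve.quadraticTwist_a₁,
      WeierstrassCurve.baseChange, WeierstrassCurve.map_a₁, map_zero]
    ring
  · simp only [WeierstrassCurve.variableChange_a₂, WeierstrassCurve.quadraticTwist_a₁,
      WeierstrassCurve.quadraticTwist_a₂, WeierstrassCurve.b₂, WeierstrassCurve.baseChange,
      WeierstrassCurve.map_a₁, WeierstrassCurve.map_a₂, h1, Units.val_inv_eq_inv_val,
      Units.val_mk0, inv_inv, map_zero, map_mul, map_intCast, map_ofNat]
    field_simp
    ring
  · simp only [WeierstrassCurve.variableChange_a₃, WeierstrassCurve.quadraticTwist_a₁,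
      WeierstrassCurve.quadraticTwist_a₃, WeierstrassCurve.baseChange, WeierstrassCurve.map_a₃,
      Units.val_inv_eq_inv_val, Units.val_mk0, inv_inv, map_mul, map_ofNat]
    field_simp
    ring
  · simp only [WeierstrassCurve.variableChange_a₄, WeierstrassCurve.quadraticTwist_a₁,
      WeierstrassCurve.quadraticTwist_a₃, WeierstrassCurve.quadraticTwist_a₄,
      WeierstrassCurve.b₄, WeierstrassCurve.baseChange, WeierstrassCurve.map_a₁,
      WeierstrassCurve.map_a₃, WeierstrassCurve.map_a₄, h1, Units.val_inv_eq_inv_val,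
      Units.val_mk0, inv_inv, map_zero, map_mul, map_pow, map_intCast, map_ofNat]
    field_simp
    ring
  · simp only [WeierstrassCurve.variableChange_a₆, WeierstrassCurve.quadraticTwist_a₁,
      WeierstrassCurve.quadraticTwist_a₃, WeierstrassCurve.quadraticTwist_a₄,
      WeierstrassCurve.quadraticTwist_a₆, WeierstrassCurve.b₆, WeierstrassCurve.baseChange,
      WeierstrassCurve.map_a₃, WeierstrassCurve.map_a₆, Units.val_inv_eq_inv_val,
      Units.val_mk0, inv_inv, map_mul, map_pow, map_sub, map_add, map_intCast, map_ofNat]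
    field_simp
    ring

/-- **Supersingular case, `d = 2d₁`: `(V ⊗ K)^{(2d₁)} = ⟨0, 2d₁a₂, 0, 4d₁²a₄, 2d₁³b₆⟩`** on the
nose, for `a₁ = 0`.  Silverman *AEC* III.1. [cite: SilvermanAEC2009, III.1 Table 3.1] -/
theorem quadraticTwist_eq_modelTwo' {ε : R} (hε : (2 : R) = uniformizer R * ε)
    (hεu : IsUnit ε) (V : WeierstrassCurve R) (h1 : V.a₁ = 0) (d₁ : ℤ) :
    (V.baseChange K).quadraticTwist ((2 * d₁ : ℤ) : K) =
      (⟨0, 2 * (d₁ : R) * V.a₂, 0, 4 * (d₁ : R) ^ 2 * V.a₄,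
        2 * (d₁ : R) ^ 3 * (V.a₃ ^ 2 + 4 * V.a₆)⟩ : WeierstrassCurve R).baseChange K := by
  obtain ⟨h20, h40⟩ := two_ne_zero_and_four_ne_zero (K := K) hε hεu
  ext
  · simp only [WeierstrassCurve.quadraticTwist_a₁, WeierstrassCurve.baseChange,
      WeierstrassCurve.map_a₁, map_zero]
  · simp only [WeierstrassCurve.quadraticTwist_a₂, WeierstrassCurve.b₂,
      WeierstrassCurve.baseChange, WeierstrassCurve.map_a₁, WeierstrassCurve.map_a₂, h1, map_zero,
      map_mul, map_intCast, map_ofNat, Int.cast_mul, Int.cast_ofNat]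
    field_simp
    ring
  · simp only [WeierstrassCurve.quadraticTwist_a₃, WeierstrassCurve.baseChange,
      WeierstrassCurve.map_a₃, map_zero]
  · simp only [WeierstrassCurve.quadraticTwist_a₄, WeierstrassCurve.b₄,
      WeierstrassCurve.baseChange, WeierstrassCurve.map_a₁, WeierstrassCurve.map_a₃,
      WeierstrassCurve.map_a₄, h1, map_zero, map_mul, map_pow, map_intCast, map_ofNat,
      Int.cast_mul, Int.cast_ofNat]
    field_simp
    ring
  · simp only [WeierstrassCurve.quadraticTwist_a₆, WeierstrassCurve.b₆,
      WeierstrassCurve.baseChange, WeierstrassCurve.map_a₃, WeierstrassCurve.map_a₆, map_mul,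
      map_pow, map_add, map_intCast, map_ofNat, Int.cast_mul, Int.cast_ofNat]
    field_simp
    ring

end Models

end TwistGoodTwo

end Literature.NumberTheory.EllipticCurves
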